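import Summits.QuantumFields.BalabanUV.Beta.FP.PolarizationGermGhost
import Summits.QuantumFields.BalabanUV.Beta.FP.PolarizationColour
import Summits.QuantumFields.BalabanUV.Beta.FP.HorizontalGerm
import Summits.QuantumFields.BalabanUV.Beta.FP.FarRegionSmearGraded

/-!
# `BalabanUV.Beta.FP.PerfectPolarizationGerm` — road «FP» for binder row D1, leaf (H2), row **H2-ASM-5** (owner END), module C:
# `hgerm` FOR THE EXPLICIT KERNEL `PiBF` — the window second moment of the background-Feynman polarization of the unit-lattice perfect theory, over
# ADMISSIBLE vertex data whose germs are the BF germs (`cubicGermOf V = cQ•bfGerm`, `cubicGermOfSc v = ghostGerm`) and whose weights satisfy the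
# TOTAL colour equation `(10·wg·(c₄cQ)² + wgh·c₄²∕2)∕3 = kappaBal N`, is `(11N²∕12π²)·log M + O(1)` with the slope of `B12Normalization.stepBal`

HONEST DEPENDENCY (page 1, mandatory): continuum YM on T⁴ ⇐ BetaPertH ∧ nine spine estimates (0/9 proved); BetaPertH ⇐ (D1) ∧ (D4) ∧
CAP+tail; G-an2-4 gates asym, D1 and NE2/3/4.  HONEST FRAMING (cell contract, verbatim): «discharging `BetaPertH` makes Bałaban's UV
stability UNCONDITIONAL — a real constructive-QFT result; it is NOT the continuum limit and NOT the Clay problem.»  THIS MODULE is the owner's composition BY NAME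
of tree theorems: modules A∕B (`PolarizationGermPker.abs_bubble_Pker_sub_leadGerm_le`, `PolarizationGermGhost.abs_bubble_G0ker_sub_leadGermSc_le`), the tadpole face
`PolarizationGerm.abs_half_tadpole_le` under the (W-loc) letter (E-FP-8-1), FILE 1's germ face `PolarizationGermBubble.germFace_eq`, H2-ASM-4's value
`PolarizationColour.germPol_hval_of_total`, and the horizontal-route END `HorizontalGerm.hgerm_stepBal_of_leadingGerm`.  EVERY analytic∕algebraic letter on the vertex data
is a HYPOTHESIS displayed in the signature — (a1)(a2)(a3) for both sectors, (W-loc) for both quartic tables, the two GERM IDENTITIES (H2V-1∕2: `cubicGermOf V = cQ • bfGerm`;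
H2V-3: `cubicGermOfSc v = ghostGerm`) and the TOTAL colour equation of the weights (H2-ASM-4's display: at canonical legs and `cQ = 1` it reads `wg = 2N²`, `wgh = 4N²`,
an3's dictionary — NOT asserted here).  No `def`, no `def … : Prop`, nothing cited, 0 sorry.  WHAT IT IS: `hgerm` for an EXPLICIT kernel on `ℤ⁴` (the road's `K` of
the γ-END), with an m-free (here: M-free) constant; the small shells `‖z‖∞ ≤ 3` are absorbed by a FINITE maximum, the far shells by the `‖z‖⁻⁷` germ remainders and the
exponentially small tadpoles.  WHAT IT IS NOT: not (K6)∕(Kcov)∕(K0) (H2-ASM-5a: `PerfectPolarizationWard` ✓ …), not the perfect action's jets (H2V-4), 0∕4 row-D1 binders;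
NOT hbook, NOT D1, NOT BetaPertH, NOT continuum, NOT Clay.

ABSOLUTE RULE (cell charter, verbatim): «No internally-minted statement may enter as a cited fact. Every hypothesis is either kernel-proved in this
package or a verbatim quotation of a PUBLISHED theorem with page reference. The manuscript(s) under audit are NOT citable for their own disputed
steps — they are the thing under adjudication; programme-internal (2001/route/tribunal) claims are never citable.»

CONTENT.
* §1 [folklore] helpers: `exp_neg_l1_le_div_pow_seven` (`e^{−δ|z|₁} ≤ 5040∕(δ⁷‖z‖∞⁷)` for `z ≠ 0`), `abs_le_of_le_div_pow` shell arithmetic.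
* §2 [our object] **`abs_PiBF_sub_germFace_le_far`** — for `4 ≤ ‖z‖∞`: `|PiBF … μ ν z − germFace(z)| ≤ A_far∕‖z‖∞⁷` with the displayed
  `A_far = |wg|·(T_P·5040∕δ⁷ + ½·Cbub_P) + |wgh|·(T_G·5040∕δ⁷ + ½·Cbub_G)` (tadpole constants `T_P = ½·|Fib 3|²·Cw·Θ δ 0·A0P`, `T_G = ½·1·Cw′·Θ δ 0·U₀`);
  **`abs_moment_PiBF_sub_leadingIntegrand_le_far`** — times `z_μ z_ν`, minus `leadingIntegrand (kappaBal N)`: `≤ A_far∕‖z‖∞⁵` (`μ ≠ ν`).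
* §3 [our object] **`shellLetter_PiBF`** (`∃ C″ ≥ 0`, ALL shells) and **`hgerm_PiBF`**: `∃ Cg, ∀ M ≥ 1, |Σ_{0<‖z‖∞≤M} PiBF μ ν z·z_μ·z_ν − (11N²∕(12π²))·log M| ≤ Cg`.
Provenance: road FP OWNER b2b-balaban-beta-d1-p3 gen 8 (prover-b2b-balaban-beta-d1-p3-g8-0), 2026-08-21, row H2-ASM-5 module C; «not in print; our bookkeeping».
-/

noncomputable section

namespace Summit.QuantumFields.BalabanUV.Beta.FP.PerfectPolarizationGerm

open Finset fwdDiff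
open scoped BigOperators
open Literature.Probability.LatticeModels (latticeGreen annulus box)
open Literature.MathematicalPhysics.QuantumFieldTheory.Balaban1983to89
open Literature.MathematicalPhysics.QuantumFieldTheory.Balaban1983to89.Beta
open Literature.MathematicalPhysics.QuantumFieldTheory.Balaban1983to89.Beta.TransverseStructure
open Literature.MathematicalPhysics.QuantumFieldTheory.Balaban1983to89.Beta.BubbleTransfer
open Literature.MathematicalPhysics.QuantumFieldTheory.Balaban1983to89.Beta.TwoPowerLegs (TwoPower free free_g)
open B12Sec2to5 (l1 l1_nonneg)
open ExpKernelCalculus (Site MKer BiLoc bubble tadpole hessKer shiftK Zl)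
open OneStepResolventKernel (Fib LocStencil)
open DyadicShell (Pt supNorm toReal toReal_apply supNorm_pos supNorm_eq_zero_iff mem_box_iff mem_annulus_iff supNorm_eq_of_mem_sphere)
open LeadingCoefficient (leadingIntegrand kappaBal)
open Summit.QuantumFields.BalabanUV.Beta.FP.MarginalUniqueness (Idx CubicGerm)
open Summit.QuantumFields.BalabanUV.Beta.FP.WilsonCubicGerm (cubicGermOf)
open Summit.QuantumFields.BalabanUV.Beta.FP.GhostCubicGerm (cubicGermOfSc)
open Summit.QuantumFields.BalabanUV.Beta.FP.BubbleGermValue (bfGerm ghostGerm)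
open Summit.QuantumFields.BalabanUV.Beta.FP.PolarizationGermBubble (leadGerm leadGermSc germFace_eq)
open Summit.QuantumFields.BalabanUV.Beta.FP.PolarizationGermLegs (Cbub)
open Summit.QuantumFields.BalabanUV.Beta.FP.PolarizationGerm (abs_half_tadpole_le)
open Summit.QuantumFields.BalabanUV.Beta.FP.PolarizationGermPker (abs_bubble_Pker_sub_leadGerm_le)
open Summit.QuantumFields.BalabanUV.Beta.FP.PolarizationGermGhost (abs_bubble_G0ker_sub_leadGermSc_le)
open Summit.QuantumFields.BalabanUV.Beta.FP.PerfectPolarization (Pker G0ker G0ker_apply PiBF PiBF_def Pker_translate G0ker_translate)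
open Summit.QuantumFields.BalabanUV.Beta.FP.PerfectPropagatorLegData (A0P A1P A2P A3P D0P D1P D2P)
open Summit.QuantumFields.BalabanUV.Beta.FP.PerfectPropagatorLegDataFree (B3free)
open Summit.QuantumFields.BalabanUV.Beta.FP.ExpLocalisedBubblePker (abs_Pker_le)
open Summit.QuantumFields.BalabanUV.Beta.FP.ExpLocalisedBubbleOrder2Point (Θ Θ_nonneg)
open Summit.QuantumFields.BalabanUV.Beta.FP.PolarizationColour (germPol_hval_of_total)
open Summit.QuantumFields.BalabanUV.Beta.FP.HorizontalGerm (hgerm_stepBal_of_leadingGerm)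
open Summit.QuantumFields.BalabanUV.Beta.FP.FarRegionSmearGraded (pow_mul_exp_neg_le)
open Summit.QuantumFields.BalabanUV.Beta.FP.LegPairingBounds (supNorm_le_l1)

/-! ## §1 Helpers -/

/-- [folklore] exponential smallness in the bond separation beats seven powers: `e^{−δ|z|₁} ≤ 5040∕(δ⁷·‖z‖∞⁷)` (`δ > 0`, `z ≠ 0`). -/
theorem exp_neg_l1_le_div_pow_seven {δ : ℝ} (hδ : 0 < δ) {z : Pt} (hz : z ≠ 0) :
    Real.exp (-δ * l1 z) ≤ 5040 / δ ^ 7 / (supNorm z : ℝ) ^ 7 := by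
  have hs : (0 : ℝ) < supNorm z := by exact_mod_cast supNorm_pos hz
  have h1 : Real.exp (-δ * l1 z) ≤ Real.exp (-δ * (supNorm z : ℝ)) := by
    apply Real.exp_le_exp.mpr; have := supNorm_le_l1 z; nlinarith
  have h2 := pow_mul_exp_neg_le hδ hs.le 7
  have e7 : ((Nat.factorial 7 : ℕ) : ℝ) = 5040 := by norm_num [Nat.factorial]
  rw [e7] at h2
  rw [le_div_iff₀ (pow_pos hs 7)]
  calc Real.exp (-δ * l1 z) * (supNorm z : ℝ) ^ 7 ≤ Real.exp (-δ * (supNorm z : ℝ)) * (supNorm z : ℝ) ^ 7 :=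
        mul_le_mul_of_nonneg_right h1 (by positivity)
    _ = (supNorm z : ℝ) ^ 7 * Real.exp (-δ * (supNorm z : ℝ)) := by ring
    _ ≤ 5040 / δ ^ 7 := h2

/-! ## §2 The far shells: `PiBF` against its germ face -/

section Far

variable {V : Fin 4 → Site 4 → MKer 4 (Fib 3)} {W : Fin 4 → Site 4 → Fin 4 → Site 4 → MKer 4 (Fib 3)}
  {v : Fin 4 → Site 4 → MKer 4 Unit} {w : Fin 4 → Site 4 → Fin 4 → Site 4 → MKer 4 Unit}
  {Cs δ Cw Cw' cQ wg wgh : ℝ}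

/-- **`PiBF` AGAINST ITS GERM FACE ON THE FAR SHELLS** [our object]: for admissible data of both sectors (letters (a1)(a2)(a3), the germ identities of H2V-1∕2∕3,
the (W-loc) letters of both quartic tables) and `4 ≤ ‖z‖∞`,
`|PiBF wg wgh V W v w μ ν z − (wg·(−½·leadGerm c₄ (cQ•bfGerm) μ ν X) − wgh·(−½·leadGermSc c₄ ghostGerm μ ν X))| ≤ A_far ∕ ‖z‖∞⁷` (`X = toReal z`), `A_far` displayed. -/
theorem abs_PiBF_sub_germFace_le_far (hδ : 0 < δ)
    (hV : LocStencil V Cs δ) (hcovV : ∀ (lam : Fin 4) (u : Site 4), V lam u = shiftK (-u) (V lam 0))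
    (h0V : ∀ (lam α β : Fin 4), ∑' p : Pt × Pt, V lam 0 p.1 p.2 (Sum.inl α) (Sum.inl β) = 0)
    (hgermV : cubicGermOf V = cQ • bfGerm)
    (hW : ∀ (μ ν : Fin 4) (z : Pt), BiLoc (W μ 0 ν z) 0 z (Cw * Real.exp (-δ * l1 z)) δ)
    (hv : ∀ (lam : Fin 4) (u : Site 4), BiLoc (v lam u) u u Cs δ) (hcovv : ∀ (lam : Fin 4) (u : Site 4), v lam u = shiftK (-u) (v lam 0))
    (h0v : ∀ lam : Fin 4, ∑' p : Pt × Pt, v lam 0 p.1 p.2 () () = 0)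
    (hgermv : cubicGermOfSc v = ghostGerm)
    (hw : ∀ (μ ν : Fin 4) (z : Pt), BiLoc (w μ 0 ν z) 0 z (Cw' * Real.exp (-δ * l1 z)) δ)
    (μ ν : Fin 4) {z : Pt} (hz : 4 ≤ supNorm z) :
    |PiBF wg wgh V W v w μ ν z
        - (wg * (-(1 / 2 : ℝ) * leadGerm c4 (cQ • bfGerm) μ ν (toReal z)) - wgh * (-(1 / 2 : ℝ) * leadGermSc c4 ghostGerm μ ν (toReal z)))|
      ≤ (|wg| * ((1 / 2 : ℝ) * ((Fintype.card (Fib 3) : ℝ) ^ 2 * (Cw * Θ δ 0 * A0P)) * (5040 / δ ^ 7)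
            + (1 / 2 : ℝ) * Cbub 4 Cs δ A0P A1P A2P A3P D0P D1P D2P)
          + |wgh| * ((1 / 2 : ℝ) * ((Fintype.card Unit : ℝ) ^ 2 * (Cw' * Θ δ 0 * free.U)) * (5040 / δ ^ 7)
            + (1 / 2 : ℝ) * Cbub 1 Cs δ (4 * (free.U + c4 + free.B)) (8 * (2 * free.U + 2 * c4 + free.Bgrad))
                (2 ^ 4 * (64 * B3free + 89098 * c4) + ((4 : ℕ) + 1 : ℝ) ^ 4 * (4 * free.U))
                (2 ^ 5 * (128 * B3free + 701568 * c4) + ((6 : ℕ) + 1 : ℝ) ^ 5 * (8 * free.U))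
                free.B (B3free + 112 * c4) (64 * B3free + 89088 * c4)))
        / (supNorm z : ℝ) ^ 7 := by
  have hz0 : z ≠ 0 := by
    intro h; rw [h] at hz; rw [supNorm_eq_zero_iff.mpr rfl] at hz; omega
  have hs : (0 : ℝ) < supNorm z := by exact_mod_cast supNorm_pos hz0
  have hs1 : (1 : ℝ) ≤ supNorm z := by exact_mod_cast supNorm_pos hz0
  set s : ℝ := (supNorm z : ℝ) with hsdef
  -- the four faces
  set bubP := bubble Pker (V μ 0) (V ν z)
  set tadP := tadpole Pker (W μ 0 ν z)
  set bubG := bubble G0ker (v μ 0) (v ν z)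
  set tadG := tadpole G0ker (w μ 0 ν z)
  set LP := leadGerm c4 (cQ • bfGerm) μ ν (toReal z)
  set LG := leadGermSc c4 ghostGerm μ ν (toReal z)
  have hPi : PiBF wg wgh V W v w μ ν z = wg * ((1 / 2 : ℝ) * tadP - (1 / 2 : ℝ) * bubP) - wgh * ((1 / 2 : ℝ) * tadG - (1 / 2 : ℝ) * bubG) := by
    rw [PiBF_def]; rfl
  -- bubbles against germs (modules A and B), rewritten through the germ identities
  have hbP : |bubP - LP| ≤ Cbub 4 Cs δ A0P A1P A2P A3P D0P D1P D2P / s ^ 7 := by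
    have h := abs_bubble_Pker_sub_leadGerm_le hδ hV hcovV h0V μ ν hz
    rwa [hgermV] at h
  have hbG : |bubG - LG| ≤ Cbub 1 Cs δ (4 * (free.U + c4 + free.B)) (8 * (2 * free.U + 2 * c4 + free.Bgrad))
      (2 ^ 4 * (64 * B3free + 89098 * c4) + ((4 : ℕ) + 1 : ℝ) ^ 4 * (4 * free.U))
      (2 ^ 5 * (128 * B3free + 701568 * c4) + ((6 : ℕ) + 1 : ℝ) ^ 5 * (8 * free.U))
      free.B (B3free + 112 * c4) (64 * B3free + 89088 * c4) / s ^ 7 := by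
    have h := abs_bubble_G0ker_sub_leadGermSc_le hδ hv hcovv h0v μ ν hz
    rwa [hgermv] at h
  -- tadpoles (W-loc), then the exponential against seven powers
  have hU : ∀ x y (a b : Unit), |G0ker x y a b| ≤ free.U := by
    intro x y a b; rw [G0ker_apply]; have h := free.bdd 0 0 (y - x); rwa [free_g] at h
  have htP : |(1 / 2 : ℝ) * tadP| ≤ (1 / 2 : ℝ) * ((Fintype.card (Fib 3) : ℝ) ^ 2 * (Cw * Real.exp (-δ * l1 z) * Θ δ 0 * A0P)) :=
    abs_half_tadpole_le hδ abs_Pker_le Pker_translate hW μ ν z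
  have htG : |(1 / 2 : ℝ) * tadG| ≤ (1 / 2 : ℝ) * ((Fintype.card Unit : ℝ) ^ 2 * (Cw' * Real.exp (-δ * l1 z) * Θ δ 0 * free.U)) :=
    abs_half_tadpole_le hδ hU G0ker_translate hw μ ν z
  have hexp := exp_neg_l1_le_div_pow_seven hδ hz0
  -- nonnegativity of the tadpole constants (from the letters at `z = 0`… we only need the products to be comparable; use the bounds' own nonnegativity)
  have hCw : 0 ≤ Cw * Θ δ 0 * A0P := by
    have h := htP
    have hE : 0 < Real.exp (-δ * l1 z) := Real.exp_pos _
    have h' : 0 ≤ (1 / 2 : ℝ) * ((Fintype.card (Fib 3) : ℝ) ^ 2 * (Cw * Real.exp (-δ * l1 z) * Θ δ 0 * A0P)) := (abs_nonneg _).trans h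
    have hc : (0 : ℝ) < (Fintype.card (Fib 3) : ℝ) ^ 2 := by positivity
    have : 0 ≤ Cw * Real.exp (-δ * l1 z) * Θ δ 0 * A0P := by nlinarith
    have e : Cw * Real.exp (-δ * l1 z) * Θ δ 0 * A0P = Real.exp (-δ * l1 z) * (Cw * Θ δ 0 * A0P) := by ring
    rw [e] at this
    exact (mul_nonneg_iff_of_pos_left hE).mp this
  have hCw' : 0 ≤ Cw' * Θ δ 0 * free.U := by
    have h := htG
    have hE : 0 < Real.exp (-δ * l1 z) := Real.exp_pos _
    have h' : 0 ≤ (1 / 2 : ℝ) * ((Fintype.card Unit : ℝ) ^ 2 * (Cw' * Real.exp (-δ * l1 z) * Θ δ 0 * free.U)) := (abs_nonneg _).trans h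
    have hc : (0 : ℝ) < (Fintype.card Unit : ℝ) ^ 2 := by positivity
    have : 0 ≤ Cw' * Real.exp (-δ * l1 z) * Θ δ 0 * free.U := by nlinarith
    have e : Cw' * Real.exp (-δ * l1 z) * Θ δ 0 * free.U = Real.exp (-δ * l1 z) * (Cw' * Θ δ 0 * free.U) := by ring
    rw [e] at this
    exact (mul_nonneg_iff_of_pos_left hE).mp this
  have htP' : |(1 / 2 : ℝ) * tadP| ≤ (1 / 2 : ℝ) * ((Fintype.card (Fib 3) : ℝ) ^ 2 * (Cw * Θ δ 0 * A0P)) * (5040 / δ ^ 7) / s ^ 7 := by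
    refine htP.trans ?_
    have e : (1 / 2 : ℝ) * ((Fintype.card (Fib 3) : ℝ) ^ 2 * (Cw * Real.exp (-δ * l1 z) * Θ δ 0 * A0P))
        = (1 / 2 : ℝ) * ((Fintype.card (Fib 3) : ℝ) ^ 2 * (Cw * Θ δ 0 * A0P)) * Real.exp (-δ * l1 z) := by ring
    rw [e, mul_div_assoc]
    exact mul_le_mul_of_nonneg_left hexp (by positivity)
  have htG' : |(1 / 2 : ℝ) * tadG| ≤ (1 / 2 : ℝ) * ((Fintype.card Unit : ℝ) ^ 2 * (Cw' * Θ δ 0 * free.U)) * (5040 / δ ^ 7) / s ^ 7 := by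
    refine htG.trans ?_
    have e : (1 / 2 : ℝ) * ((Fintype.card Unit : ℝ) ^ 2 * (Cw' * Real.exp (-δ * l1 z) * Θ δ 0 * free.U))
        = (1 / 2 : ℝ) * ((Fintype.card Unit : ℝ) ^ 2 * (Cw' * Θ δ 0 * free.U)) * Real.exp (-δ * l1 z) := by ring
    rw [e, mul_div_assoc]
    exact mul_le_mul_of_nonneg_left hexp (by positivity)
  -- assemble
  have e : PiBF wg wgh V W v w μ ν z - (wg * (-(1 / 2 : ℝ) * LP) - wgh * (-(1 / 2 : ℝ) * LG))
      = wg * ((1 / 2 : ℝ) * tadP - (1 / 2 : ℝ) * (bubP - LP)) - wgh * ((1 / 2 : ℝ) * tadG - (1 / 2 : ℝ) * (bubG - LG)) := by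
    rw [hPi]; ring
  rw [e]
  have h1 : |wg * ((1 / 2 : ℝ) * tadP - (1 / 2 : ℝ) * (bubP - LP))|
      ≤ |wg| * (((1 / 2 : ℝ) * ((Fintype.card (Fib 3) : ℝ) ^ 2 * (Cw * Θ δ 0 * A0P)) * (5040 / δ ^ 7) / s ^ 7)
        + (1 / 2 : ℝ) * (Cbub 4 Cs δ A0P A1P A2P A3P D0P D1P D2P / s ^ 7)) := by
    rw [abs_mul]
    refine mul_le_mul_of_nonneg_left ((abs_sub _ _).trans (add_le_add htP' ?_)) (abs_nonneg _)
    rw [abs_mul, abs_of_pos (by norm_num : (0 : ℝ) < 1 / 2)]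
    exact mul_le_mul_of_nonneg_left hbP (by norm_num)
  have h2 : |wgh * ((1 / 2 : ℝ) * tadG - (1 / 2 : ℝ) * (bubG - LG))|
      ≤ |wgh| * (((1 / 2 : ℝ) * ((Fintype.card Unit : ℝ) ^ 2 * (Cw' * Θ δ 0 * free.U)) * (5040 / δ ^ 7) / s ^ 7)
        + (1 / 2 : ℝ) * (Cbub 1 Cs δ (4 * (free.U + c4 + free.B)) (8 * (2 * free.U + 2 * c4 + free.Bgrad))
            (2 ^ 4 * (64 * B3free + 89098 * c4) + ((4 : ℕ) + 1 : ℝ) ^ 4 * (4 * free.U))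
            (2 ^ 5 * (128 * B3free + 701568 * c4) + ((6 : ℕ) + 1 : ℝ) ^ 5 * (8 * free.U))
            free.B (B3free + 112 * c4) (64 * B3free + 89088 * c4) / s ^ 7)) := by
    rw [abs_mul]
    refine mul_le_mul_of_nonneg_left ((abs_sub _ _).trans (add_le_add htG' ?_)) (abs_nonneg _)
    rw [abs_mul, abs_of_pos (by norm_num : (0 : ℝ) < 1 / 2)]
    exact mul_le_mul_of_nonneg_left hbG (by norm_num)
  refine ((abs_sub _ _).trans (add_le_add h1 h2)).trans (le_of_eq ?_)
  field_simp

/-- **THE FAR-SHELL LETTER OF `hgerm` FOR `PiBF`** [our object] (`μ ≠ ν`, `4 ≤ ‖z‖∞`): with the weights' TOTAL colour equation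
`(40·wg·¼·(c₄cQ)² − wgh·(−½)·c₄²)∕3 = kappaBal N` (H2-ASM-4's face at `(aB,aG) = (¼,−½)`, legs `cL = cG = c₄`),
`|PiBF μ ν z·z_μ·z_ν − leadingIntegrand (kappaBal N) μ ν (toReal z)| ≤ A_far ∕ ‖z‖∞⁵`. -/
theorem abs_moment_PiBF_sub_leadingIntegrand_le_far (hδ : 0 < δ)
    (hV : LocStencil V Cs δ) (hcovV : ∀ (lam : Fin 4) (u : Site 4), V lam u = shiftK (-u) (V lam 0))
    (h0V : ∀ (lam α β : Fin 4), ∑' p : Pt × Pt, V lam 0 p.1 p.2 (Sum.inl α) (Sum.inl β) = 0)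
    (hgermV : cubicGermOf V = cQ • bfGerm)
    (hW : ∀ (μ ν : Fin 4) (z : Pt), BiLoc (W μ 0 ν z) 0 z (Cw * Real.exp (-δ * l1 z)) δ)
    (hv : ∀ (lam : Fin 4) (u : Site 4), BiLoc (v lam u) u u Cs δ) (hcovv : ∀ (lam : Fin 4) (u : Site 4), v lam u = shiftK (-u) (v lam 0))
    (h0v : ∀ lam : Fin 4, ∑' p : Pt × Pt, v lam 0 p.1 p.2 () () = 0)
    (hgermv : cubicGermOfSc v = ghostGerm)
    (hw : ∀ (μ ν : Fin 4) (z : Pt), BiLoc (w μ 0 ν z) 0 z (Cw' * Real.exp (-δ * l1 z)) δ)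
    {N : ℝ} (hn : (40 * wg * (1 / 4 : ℝ) * (c4 * cQ) ^ 2 - wgh * (-(1 / 2 : ℝ)) * c4 ^ 2) / 3 = kappaBal N)
    {μ ν : Fin 4} (hμν : μ ≠ ν) {z : Pt} (hz : 4 ≤ supNorm z) :
    |PiBF wg wgh V W v w μ ν z * (z μ : ℝ) * (z ν : ℝ) - leadingIntegrand (kappaBal N) μ ν (toReal z)|
      ≤ (|wg| * ((1 / 2 : ℝ) * ((Fintype.card (Fib 3) : ℝ) ^ 2 * (Cw * Θ δ 0 * A0P)) * (5040 / δ ^ 7)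
            + (1 / 2 : ℝ) * Cbub 4 Cs δ A0P A1P A2P A3P D0P D1P D2P)
          + |wgh| * ((1 / 2 : ℝ) * ((Fintype.card Unit : ℝ) ^ 2 * (Cw' * Θ δ 0 * free.U)) * (5040 / δ ^ 7)
            + (1 / 2 : ℝ) * Cbub 1 Cs δ (4 * (free.U + c4 + free.B)) (8 * (2 * free.U + 2 * c4 + free.Bgrad))
                (2 ^ 4 * (64 * B3free + 89098 * c4) + ((4 : ℕ) + 1 : ℝ) ^ 4 * (4 * free.U))
                (2 ^ 5 * (128 * B3free + 701568 * c4) + ((6 : ℕ) + 1 : ℝ) ^ 5 * (8 * free.U))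
                free.B (B3free + 112 * c4) (64 * B3free + 89088 * c4)))
        / (supNorm z : ℝ) ^ 5 := by
  have hz0 : z ≠ 0 := by
    intro h; rw [h] at hz; rw [supNorm_eq_zero_iff.mpr rfl] at hz; omega
  have hx0 : toReal z ≠ 0 := fun h => hz0 (DyadicShell.toReal_eq_zero_iff.mp h)
  have hs : (0 : ℝ) < supNorm z := by exact_mod_cast supNorm_pos hz0
  set A : ℝ := (|wg| * ((1 / 2 : ℝ) * ((Fintype.card (Fib 3) : ℝ) ^ 2 * (Cw * Θ δ 0 * A0P)) * (5040 / δ ^ 7)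
            + (1 / 2 : ℝ) * Cbub 4 Cs δ A0P A1P A2P A3P D0P D1P D2P)
          + |wgh| * ((1 / 2 : ℝ) * ((Fintype.card Unit : ℝ) ^ 2 * (Cw' * Θ δ 0 * free.U)) * (5040 / δ ^ 7)
            + (1 / 2 : ℝ) * Cbub 1 Cs δ (4 * (free.U + c4 + free.B)) (8 * (2 * free.U + 2 * c4 + free.Bgrad))
                (2 ^ 4 * (64 * B3free + 89098 * c4) + ((4 : ℕ) + 1 : ℝ) ^ 4 * (4 * free.U))
                (2 ^ 5 * (128 * B3free + 701568 * c4) + ((6 : ℕ) + 1 : ℝ) ^ 5 * (8 * free.U))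
                free.B (B3free + 112 * c4) (64 * B3free + 89088 * c4))) with hA
  have hfar := abs_PiBF_sub_germFace_le_far (wg := wg) (wgh := wgh) (cQ := cQ) hδ hV hcovV h0V hgermV hW hv hcovv h0v hgermv hw μ ν hz
  rw [← hA] at hfar
  have hA0 : 0 ≤ A := by
    have h := (abs_nonneg _).trans hfar
    exact (div_nonneg_iff.mp h).elim (fun h => h.1) (fun h => absurd h.2 (not_le.mpr (pow_pos hs 7)))
  -- the germ face IS the leading integrand in the off-diagonal moment
  have hval : (toReal z) μ * (toReal z) ν
        * (wg * (-(1 / 2 : ℝ) * leadGerm c4 (cQ • bfGerm) μ ν (toReal z)) - wgh * (-(1 / 2 : ℝ) * leadGermSc c4 ghostGerm μ ν (toReal z)))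
      = leadingIntegrand (kappaBal N) μ ν (toReal z) := by
    rw [germFace_eq]
    exact germPol_hval_of_total hn hμν hx0
  have e : PiBF wg wgh V W v w μ ν z * (z μ : ℝ) * (z ν : ℝ) - leadingIntegrand (kappaBal N) μ ν (toReal z)
      = ((toReal z) μ * (toReal z) ν) * (PiBF wg wgh V W v w μ ν z
          - (wg * (-(1 / 2 : ℝ) * leadGerm c4 (cQ • bfGerm) μ ν (toReal z)) - wgh * (-(1 / 2 : ℝ) * leadGermSc c4 ghostGerm μ ν (toReal z)))) := by
    rw [← hval, toReal_apply, toReal_apply]; ring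
  rw [e, abs_mul]
  calc |(toReal z) μ * (toReal z) ν| * |PiBF wg wgh V W v w μ ν z
          - (wg * (-(1 / 2 : ℝ) * leadGerm c4 (cQ • bfGerm) μ ν (toReal z)) - wgh * (-(1 / 2 : ℝ) * leadGermSc c4 ghostGerm μ ν (toReal z)))|
      ≤ (supNorm z : ℝ) ^ 2 * (A / (supNorm z : ℝ) ^ 7) :=
        mul_le_mul (abs_moment_le μ ν z) hfar (abs_nonneg _) (by positivity)
    _ = A / (supNorm z : ℝ) ^ 5 := by field_simp

end Far

/-! ## §3 All shells, and `hgerm` for `PiBF` -/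

section Hgerm

variable {V : Fin 4 → Site 4 → MKer 4 (Fib 3)} {W : Fin 4 → Site 4 → Fin 4 → Site 4 → MKer 4 (Fib 3)}
  {v : Fin 4 → Site 4 → MKer 4 Unit} {w : Fin 4 → Site 4 → Fin 4 → Site 4 → MKer 4 Unit}
  {Cs δ Cw Cw' cQ wg wgh : ℝ}

/-- **THE SHELL LETTER OF `hgerm` FOR `PiBF`, EVERY SHELL** [our object] (`μ ≠ ν`): `∃ C″ ≥ 0` with
`|PiBF μ ν w·w_μ·w_ν − leadingIntegrand (kappaBal N) μ ν (toReal w)| ≤ C″∕(r+1)⁵` for every `r` and every `w` on the shell `‖w‖∞ = r+1` — the far shells by §2,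
the three small shells (a FINITE set of lattice points) by their maximum. -/
theorem shellLetter_PiBF (hδ : 0 < δ)
    (hV : LocStencil V Cs δ) (hcovV : ∀ (lam : Fin 4) (u : Site 4), V lam u = shiftK (-u) (V lam 0))
    (h0V : ∀ (lam α β : Fin 4), ∑' p : Pt × Pt, V lam 0 p.1 p.2 (Sum.inl α) (Sum.inl β) = 0)
    (hgermV : cubicGermOf V = cQ • bfGerm)
    (hW : ∀ (μ ν : Fin 4) (z : Pt), BiLoc (W μ 0 ν z) 0 z (Cw * Real.exp (-δ * l1 z)) δ)
    (hv : ∀ (lam : Fin 4) (u : Site 4), BiLoc (v lam u) u u Cs δ) (hcovv : ∀ (lam : Fin 4) (u : Site 4), v lam u = shiftK (-u) (v lam 0))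
    (h0v : ∀ lam : Fin 4, ∑' p : Pt × Pt, v lam 0 p.1 p.2 () () = 0)
    (hgermv : cubicGermOfSc v = ghostGerm)
    (hw : ∀ (μ ν : Fin 4) (z : Pt), BiLoc (w μ 0 ν z) 0 z (Cw' * Real.exp (-δ * l1 z)) δ)
    {N : ℝ} (hn : (40 * wg * (1 / 4 : ℝ) * (c4 * cQ) ^ 2 - wgh * (-(1 / 2 : ℝ)) * c4 ^ 2) / 3 = kappaBal N)
    {μ ν : Fin 4} (hμν : μ ≠ ν) :
    ∃ C'' : ℝ, 0 ≤ C'' ∧ ∀ r : ℕ, ∀ u ∈ annulus 4 r (r + 1),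
      |PiBF wg wgh V W v w μ ν u * (u μ : ℝ) * (u ν : ℝ) - leadingIntegrand (kappaBal N) μ ν (toReal u)| ≤ C'' / ((r : ℝ) + 1) ^ 5 := by
  classical
  set g : Pt → ℝ := fun u => |PiBF wg wgh V W v w μ ν u * (u μ : ℝ) * (u ν : ℝ) - leadingIntegrand (kappaBal N) μ ν (toReal u)| with hg
  -- the far constant
  set A : ℝ := (|wg| * ((1 / 2 : ℝ) * ((Fintype.card (Fib 3) : ℝ) ^ 2 * (Cw * Θ δ 0 * A0P)) * (5040 / δ ^ 7)
            + (1 / 2 : ℝ) * Cbub 4 Cs δ A0P A1P A2P A3P D0P D1P D2P)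
          + |wgh| * ((1 / 2 : ℝ) * ((Fintype.card Unit : ℝ) ^ 2 * (Cw' * Θ δ 0 * free.U)) * (5040 / δ ^ 7)
            + (1 / 2 : ℝ) * Cbub 1 Cs δ (4 * (free.U + c4 + free.B)) (8 * (2 * free.U + 2 * c4 + free.Bgrad))
                (2 ^ 4 * (64 * B3free + 89098 * c4) + ((4 : ℕ) + 1 : ℝ) ^ 4 * (4 * free.U))
                (2 ^ 5 * (128 * B3free + 701568 * c4) + ((6 : ℕ) + 1 : ℝ) ^ 5 * (8 * free.U))
                free.B (B3free + 112 * c4) (64 * B3free + 89088 * c4))) with hA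
  -- the near constant: the finite maximum over the box of radius 3, times 3⁵
  set M₀ : ℝ := ∑ u ∈ box 4 3, g u with hM₀
  have hg0 : ∀ u, 0 ≤ g u := fun u => abs_nonneg _
  have hM₀0 : 0 ≤ M₀ := Finset.sum_nonneg fun u _ => hg0 u
  -- A ≥ 0 from the far bound at any point of the fourth shell
  have hA0 : 0 ≤ A := by
    set z₄ : Pt := fun _ => 4 with hz₄
    have hz : 4 ≤ supNorm z₄ := by
      have h := DyadicShell.natAbs_le_supNorm z₄ 0
      simp [hz₄] at h; omega
    have hfar := abs_moment_PiBF_sub_leadingIntegrand_le_far (wg := wg) (wgh := wgh) (cQ := cQ)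
      hδ hV hcovV h0V hgermV hW hv hcovv h0v hgermv hw hn hμν hz
    rw [← hA] at hfar
    have hs : (0 : ℝ) < supNorm z₄ := by exact_mod_cast lt_of_lt_of_le (by norm_num) hz
    have h := (abs_nonneg _).trans hfar
    exact (div_nonneg_iff.mp h).elim (fun h => h.1) (fun h => absurd h.2 (not_le.mpr (pow_pos hs 5)))
  refine ⟨A + 243 * M₀, by positivity, fun r u hu => ?_⟩
  have hsu : supNorm u = r + 1 := supNorm_eq_of_mem_sphere hu
  have hr1 : (0 : ℝ) < (r : ℝ) + 1 := by positivity
  by_cases hr : 4 ≤ r + 1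
  · -- far shell
    have hz : 4 ≤ supNorm u := by rw [hsu]; exact hr
    have hfar := abs_moment_PiBF_sub_leadingIntegrand_le_far (wg := wg) (wgh := wgh) (cQ := cQ)
      hδ hV hcovV h0V hgermV hW hv hcovv h0v hgermv hw hn hμν hz
    rw [← hA, hsu] at hfar
    push_cast at hfar
    refine hfar.trans ?_
    exact div_le_div_of_nonneg_right (by nlinarith) (by positivity)
  · -- small shell: `u ∈ box 4 3`, so `g u ≤ M₀ ≤ 243·M₀/(r+1)⁵`
    have hr3 : r + 1 ≤ 3 := by omega
    have hub : u ∈ box 4 3 := mem_box_iff.mpr (by rw [hsu]; exact hr3)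
    have h1 : g u ≤ M₀ := Finset.single_le_sum (fun u _ => hg0 u) hub
    have hr3' : ((r : ℝ) + 1) ^ 5 ≤ 243 := by
      have : (r : ℝ) + 1 ≤ 3 := by exact_mod_cast hr3
      calc ((r : ℝ) + 1) ^ 5 ≤ (3 : ℝ) ^ 5 := pow_le_pow_left₀ hr1.le this 5
        _ = 243 := by norm_num
    have h2 : M₀ ≤ (A + 243 * M₀) / ((r : ℝ) + 1) ^ 5 := by
      rw [le_div_iff₀ (pow_pos hr1 5)]
      nlinarith [pow_pos hr1 5]
    exact h1.trans h2

/-- **`hgerm` FOR THE EXPLICIT KERNEL `PiBF`** [our object] (row H2-ASM-5, the END of leaf (H2); `μ ≠ ν`): under the displayed vertex letters, germ identities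
and the total colour equation, there is `Cg` with, for every window `M ≥ 1`,
`|Σ_{0<‖z‖∞≤M} PiBF wg wgh V W v w μ ν z·z_μ·z_ν − (11N²∕(12π²)·log M + 0)| ≤ Cg` — `HorizontalGerm.hgerm_stepBal_of_leadingGerm` BY NAME on `shellLetter_PiBF`;
the slope `11N²∕(12π²)` is that of `B12Normalization.stepBal` (`stepBal_eq`): `stepBal N L = (11N²∕12π²)·log L`. -/
theorem hgerm_PiBF (hδ : 0 < δ)
    (hV : LocStencil V Cs δ) (hcovV : ∀ (lam : Fin 4) (u : Site 4), V lam u = shiftK (-u) (V lam 0))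
    (h0V : ∀ (lam α β : Fin 4), ∑' p : Pt × Pt, V lam 0 p.1 p.2 (Sum.inl α) (Sum.inl β) = 0)
    (hgermV : cubicGermOf V = cQ • bfGerm)
    (hW : ∀ (μ ν : Fin 4) (z : Pt), BiLoc (W μ 0 ν z) 0 z (Cw * Real.exp (-δ * l1 z)) δ)
    (hv : ∀ (lam : Fin 4) (u : Site 4), BiLoc (v lam u) u u Cs δ) (hcovv : ∀ (lam : Fin 4) (u : Site 4), v lam u = shiftK (-u) (v lam 0))
    (h0v : ∀ lam : Fin 4, ∑' p : Pt × Pt, v lam 0 p.1 p.2 () () = 0)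
    (hgermv : cubicGermOfSc v = ghostGerm)
    (hw : ∀ (μ ν : Fin 4) (z : Pt), BiLoc (w μ 0 ν z) 0 z (Cw' * Real.exp (-δ * l1 z)) δ)
    {N : ℝ} (hn : (40 * wg * (1 / 4 : ℝ) * (c4 * cQ) ^ 2 - wgh * (-(1 / 2 : ℝ)) * c4 ^ 2) / 3 = kappaBal N)
    {μ ν : Fin 4} (hμν : μ ≠ ν) :
    ∃ Cg : ℝ, ∀ M : ℕ, 1 ≤ M →
      |∑ z ∈ annulus 4 0 M, PiBF wg wgh V W v w μ ν z * (z μ : ℝ) * (z ν : ℝ) - (11 * N ^ 2 / (12 * Real.pi ^ 2) * Real.log M + 0)| ≤ Cg := by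
  obtain ⟨C'', hC'', hshell⟩ := shellLetter_PiBF (wg := wg) (wgh := wgh) (cQ := cQ)
    hδ hV hcovV h0V hgermV hW hv hcovv h0v hgermv hw hn hμν
  exact ⟨_, hgerm_stepBal_of_leadingGerm (K := PiBF wg wgh V W v w) N hμν hC'' hshell⟩

end Hgerm

end Summit.QuantumFields.BalabanUV.Beta.FP.PerfectPolarizationGerm

end
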